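import Literature.MathematicalPhysics.KineticTheory.RegularStationaryState
import HarnessLib

/-!
# Two named facts on the dilute hard-sphere gas: local limit of the periodic canonical ensemble, low-density uniqueness

Topic `Literature/MathematicalPhysics/KineticTheory` (next to `RegularStationaryState`, which defines the blow-up `blowUp`
of torus configurations, the window laws `PointProcess.windowLaw` and the density `PointProcess.density` these facts speak
about; the canonical torus law `localGibbsLaw` and the diameter `hsDiameter` are from `HardSphereEuler`, the DLR class
`IsHardSphereGibbs` and `IsTranslationInvariant` from `Literature/Analysis/FluidPDE/InfiniteHardSphereFlow.lean`).
Requested by crux stmt-AtomisticToContinuum-14135 (`Summits/AtomisticToContinuum/HydrodynamicLimit`, line `FirstLemma`, file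
`…Theorems/AntiMazurCoboundariesCorrectorPressureDecayKiferEntropyBound.lean`), where they reduce the specific-entropy bound for
tangent states (`TangentEntropyBound`) to its pure relative-entropy content. NAMED FACTS (unproved here):

* `Georgii1995_hardSphereCanonicalLocalLimit` — equivalence of ensembles ON THE LEVEL OF MEASURES for the periodic
  (small-)canonical hard-sphere gas (Georgii 1995, Thms 3.3–3.4, Remark 3.6): accumulation points of the spatially averaged
  canonical torus laws, seen at the scale of the sphere diameter, are translation-invariant hard-sphere Gibbs states of the
  prescribed density, with setwise convergence of all window laws along a subsequence;
* `HardSphereGibbsLowDensityUniqueness` — two translation-invariant hard-sphere Gibbs states with the same Maxwellian marks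
  and the same small density coincide (Ruelle 1969 Thm 4.2.3: uniqueness at small activity; Georgii 1995 Thm 3.4 and
  Remark 3.7: at fixed inverse temperature the density of a translation-invariant Gibbs state determines its activity).

What is deliberately NOT here: the general superstable/regular potentials and microcanonical energy shells of Georgii's
theorems, the variational principle itself (mean free energy, pressure), Ruelle's Kirkwood–Salsburg machinery (the tree's
`HardSphereKirkwoodSalsburg.lean` has the fixed point at the level of correlation functions), any activity–density expansion
(`RuelleDiluteHardSphereGas` is the neighbouring fact), and the torus flows (the flow argument of `localGibbsLaw` only fixes
the phase space).
-/

noncomputable section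

namespace Literature.MathematicalPhysics.KineticTheory

/-- **Local limit of the periodic canonical hard-sphere gas (equivalence of ensembles on the level of measures)** (NAMED
FACT). Georgii 1995, Thm 3.3: for a superstable regular pair potential (hard cores allowed, §2.1 (A2)), particle numbers
`N_n` with `N_n / v_n → ρ`, `0 < ρ < ρ_max`, the spatially averaged (micro-)canonical Gibbs distributions in the periodic
boxes `Λ_n` are relatively sequentially compact in the topology `τ_ℒ` of local convergence (all tame local observables, in
particular all bounded local events) and every accumulation point lies in `ℳ_{ρ,ε}`; Thm 3.4 with (3.12): `ℳ_{ρ,ε}` is the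
set `𝒢_Θ(z, β)` of translation-invariant tempered Gibbs measures for the tangent parameters, all of density `ρ`;
Remark 3.6 and the Introduction: the same holds for the grand canonical laws and for "pure positional ensembles" without
energy shells (for the hard core the positional canonical ensemble is of this kind), momenta being attached independently.
Recorded for the unit-diameter hard-sphere gas in `d = 3` in the tree's normalisation: `N + 1` spheres of diameter
`ε_N = σ (N+1)^{-1/3}` on the unit torus under the canonical law `localGibbsLaw σ a u₀ θ N Φ` (uniform on the hard-sphere
domain, i.i.d. Maxwellian velocities of temperature `θ` and drift `u₀`; the activity profile `a` cancels, the flow `Φ`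
only fixes the phase space), blown up by `ε_N⁻¹` around a uniformly distributed base point (`blowUp`; density
`σ³ ≤ 1/8`, far below close packing): along a subsequence of any sequence of sizes `N k → ∞` the window laws on every
bounded measurable window converge setwise to those of a translation-invariant `IsHardSphereGibbs 1 z θ⁻¹ u₀` state of
density `σ³` (locally the blown-up cube configuration and Georgii's periodic continuation agree; the Galilean boost by
`u₀` and the tree's normalised Maxwellian marks only reparametrise Georgii's `(z, β)`).
-- TODO(general form): Georgii's theorem is for superstable regular potentials, microcanonical energy shells, general
-- `N_n / v_n → ρ < ρ_max` and all `τ_ℒ`-tame local observables; only hard spheres at exact density `σ³ ≤ 1/8`,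
-- bounded measurable local events and Maxwellian marks are recorded.
[cite: Georgii1995, Thm 3.3, Thm 3.4 and Remark 3.6] -/
def Georgii1995_hardSphereCanonicalLocalLimit : Prop :=
  ∀ (σ a θ : ℝ) (u₀ : V3), 0 < σ → σ ≤ 1 / 2 → 0 < a → 0 < θ →
  ∀ (N : ℕ → ℕ)
    (Φ : ∀ k, Literature.Analysis.FluidPDE.HardSphereFlow (Literature.Analysis.FluidPDE.Torus.geometry (Fin 3))
      (hsDiameter σ (N k)) (N k + 1)),
    Filter.Tendsto N Filter.atTop Filter.atTop →
    ∃ κ : ℕ → ℕ, StrictMono κ ∧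
      ∃ (z : ℝ) (G : MeasureTheory.Measure (Literature.Analysis.FunctionSpaces.PointConfig (V3 × V3))),
        0 < z ∧ Literature.Analysis.FluidPDE.IsHardSphereGibbs 1 z θ⁻¹ u₀ G ∧
        Literature.Analysis.FluidPDE.IsTranslationInvariant G ∧
        PointProcess.density G = ENNReal.ofReal (σ ^ 3) ∧
        ∀ Λ : Set V3, MeasurableSet Λ → Bornology.IsBounded Λ →
        ∀ A : Set (Literature.Analysis.FunctionSpaces.PointConfig (V3 × V3)), MeasurableSet A →
          Filter.Tendsto (fun j => PointProcess.windowLaw Λ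
              (((MeasureTheory.volume : MeasureTheory.Measure T3).prod
                (localGibbsLaw σ (fun _ => a) (fun _ => u₀) (fun _ => θ) (N (κ j)) (Φ (κ j)))).map
                (fun p => blowUp (hsDiameter σ (N (κ j))) p.1 p.2)) A)
            Filter.atTop (nhds (PointProcess.windowLaw Λ G A))

/-- **Uniqueness of the dilute translation-invariant hard-sphere Gibbs state of prescribed density** (NAMED FACT). For the
gas of hard spheres of diameter `ε > 0` in `ℝᵈ` with independent Maxwellian velocity marks (inverse temperature `β`, drift
`u`; the tree's DLR class `IsHardSphereGibbs ε z β u`) there is `ρ₀ = ρ₀(d, ε) > 0` such that two translation-invariant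
Gibbs states with the same marks and the same density `< ρ₀` are equal, whatever their activities. Two published
ingredients: (1) Ruelle 1969, Thm 4.2.3 (with §4.1 and Ruelle 1970 for the identification of DLR states with solutions of
the Kirkwood–Salsburg equations whose correlation functions are bounded by `ξⁿ` — automatic for a non-negative potential,
`ρ_n ≤ zⁿ`): for `|z| < e^{-2βB-1} C(β)⁻¹` (hard core: `B = 0`, `C(β)` = volume of the exclusion ball) the
Kirkwood–Salsburg equations have a UNIQUE solution, so the Gibbs state of activity `z` is unique, translation invariant, of
density `ρ(z) = z + O(z²)` increasing to `ρ₀` along the radius; (2) Georgii 1995, Thm 3.4 and Remark 3.7: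
translation-invariant tempered Gibbs measures are exactly the minimisers of the mean free energy, the sets `𝒢_Θ(z, β)` are
pairwise disjoint and coincide with the sets `ℳ_{ρ,ε}` — hence at fixed `β` the density of a translation-invariant Gibbs
state determines its activity, monotonically; a density below `ρ₀` therefore forces an activity inside Ruelle's disc.
-- TODO(general form): Ruelle's theorem is for stable regular pair potentials and complex activities, Georgii's for
-- superstable regular potentials; only the hard-sphere corollary "small equal densities ⇒ equal states" is recorded.
[cite: Ruelle1969, Thm 4.2.3 (with Georgii 1995, Thm 3.4 and Remark 3.7)] -/
def HardSphereGibbsLowDensityUniqueness : Prop :=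
  ∀ (d : Type) [Fintype d] (ε : ℝ), 0 < ε → ∃ ρ₀ : ℝ, 0 < ρ₀ ∧
    ∀ (β : ℝ) (u : EuclideanSpace ℝ d) (z z' : ℝ)
      (G G' : MeasureTheory.Measure
        (Literature.Analysis.FunctionSpaces.PointConfig (EuclideanSpace ℝ d × EuclideanSpace ℝ d))),
      0 < β → 0 < z → 0 < z' →
      Literature.Analysis.FluidPDE.IsHardSphereGibbs ε z β u G → Literature.Analysis.FluidPDE.IsHardSphereGibbs ε z' β u G' →
      Literature.Analysis.FluidPDE.IsTranslationInvariant G → Literature.Analysis.FluidPDE.IsTranslationInvariant G' →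
      PointProcess.density G = PointProcess.density G' →
      PointProcess.density G < ENNReal.ofReal ρ₀ → G = G'

end Literature.MathematicalPhysics.KineticTheory

end
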